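import Summits.HodgeConjecture.HodgeConjecture.Theses.NikulinTwinTransport
import Literature.AlgebraicGeometry.Surfaces.K3HodgeTypesHolds
import Literature.AlgebraicGeometry.Surfaces.K3MarkingProofs

/-!
# Disproof of `K3PeriodSurjective` (stmt-HodgeConjecture-15154) — findings

Crux `Summit.HodgeConjecture.HodgeConjecture.Theses.NikulinTwinTransport.K3PeriodSurjective`
(route NikulinTwinTransport, rank 8) IS, definitionally, the named Literature fact
`Literature.AlgebraicGeometry.Surfaces.Huybrechts_K3_periodSurjective_projective` (surjectivity
of the period map for projective K3 surfaces, Huybrechts *Lectures on K3 Surfaces* Ch. 6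
Thm. 3.1 / Rem. 3.3, Ch. 7 Thm. 4.1, projectivity criterion Ch. 1 §3) with `IsK3Surface` unfolded
(`crux_iff_fact` below, `Iff.rfl`).

## Verdict of the standing disprover (cycle 1): NO KILL — the crux is a faithfully rendered theorem.

Attacks run (all recorded as Lean below or in the docstrings):

* **Exotic Hodge models** (the only clause of the crux where the tree's `∃`-over-`HodgeModel`
  convention is used NEGATIVELY is the span clause `∀ σ, IsOfHodgeType … 2 0 σ → σ ∈ ℂ·φ⁻¹x`):
  an exotic model enlarging `H^{2,0}` would refute the crux. DEAD: a Hodge model's complex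
  structure is pinned by `IsAnalytification` (regular functions pull back to HOLOMORPHIC ones, so
  the conjugate structure is excluded), its de Rham comparison is natural in the full sense
  (`ComplexDeRhamIsoFamily.IsNatural`, over all `C^∞` maps of manifolds charted on the model;
  `PullbackFacts` is a true `Prop`-class), and the tree PROVES that natural comparisons differ by
  scalars (`Literature.Geometry.Manifold.NaturalCohomologyEndo.exists_eq_smul`, Morse theory), whence
  `HodgeTheory.hodgePQ_independent_of_hodgeModel_holds`: the span clause may be read in any one
  model (`span_clause_iff_of_model` below). Nothing to exploit.
* **Sign / orientation** (`Λ_{K3} ≇ Λ_{K3}(−1)`): absorbed by `∃ p` (either integral generator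
  of `H⁴` may be chosen); no contradiction with `0 < re (x̄.x)` since the complex orientation
  makes `(σ̄.σ) > 0` and `H²(K3, ℤ) ≅ Λ(3,19)` simultaneously.
* **Carriers** (`IsSmoothProjective`, `structureSheafCohomology`, `complexBetti`, `cupProduct`,
  `IsIntegralClass`): genuine Mathlib/tree objects (Over Spec ℂ, Zariski sheaf cohomology,
  singular cochains, Alexander–Whitney cup product) — no junk inhabitant makes the conclusion
  cheap, no junk convention makes it impossible.
* **Degenerate parameters**: `x = 0` and real `x` are excluded by `0 < re (x̄.x)`; the statement
  is `ℂˣ`- and `O(Λ)`-invariant (tree: `Huybrechts_K3_periodSurjective_projective.hypotheses_smul`,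
  `.conclusion_smul`, `.hypotheses_of_latticeIsometry`, `.conclusion_of_latticeIsometry`).

## What IS proved here (negative knowledge for the provers)

LANDED (import it): `Summits.HodgeConjecture.HodgeConjecture.Theorems.K3PeriodSurjective.Negative.LoadBearing`
(p100170, accepted 2026-08-16T12:09Z) = §A positivity/isotropy + the marking bookkeeping
(`conjClass_symm`, `cup_conj_symm_self`, `span_clause_iff_of_model`). PART 2 (`perNP`, projectivity,
`generator_ratio_pos`) = item evidence `NonProjectivePeriod.lean` (2026-08-16T12:22Z; lean rc0 against
part 1), to be proposed to `…/Theorems/K3PeriodSurjective/Negative/NonProjectivePeriod.lean` by the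
next correctly-identified seat (this seat's proposals p101380/p102018 were attributed to `operator`
after the park/resume and bounced `perm.theorems-prover-only`).

§A LOAD-BEARING HYPOTHESES — each hypothesis of the crux is necessary, by a kernel-checked
refutation of the crux with that hypothesis dropped, using only PROVED K3 facts of the tree
(`IsK3Surface.exists_isOfHodgeType_twoZero_ne_zero`, `IsK3Surface.cupProduct_twoZero_self`,
`IsK3Surface.cupProduct_conjClass_self_ne_zero`, fed with the `_holds` discharges):
* `k3PeriodSurjective_false_without_positivity`  — drop `0 < re (x̄.x)`: `x = 0` kills it;
* `k3PeriodSurjective_false_without_positivity'` — even weakened to `x ≠ 0`: the real isotropic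
  vector `x = e₁` kills it (Hodge–Riemann `σ̄ ∪ σ ≠ 0` versus `σ̄ = σ`, `σ ∪ σ = (x.x) p = 0`);
* `k3PeriodSurjective_false_without_isotropy`   — drop `(x.x) = 0`: `x = e₁ + f₁` kills it
  (`σ ∪ σ = 0` by type forces `p = 0`, contradicting Hodge–Riemann);
* `k3PeriodSurjective_false_without_projectivity_of_marking` — drop `∃ v ∈ Λ ∩ x^⊥, v² > 0`:
  killed, GRANTED the tree's named fact `Huybrechts_K3_marking_exists` (markings with an ample
  lattice vector exist for every K3), by the explicit NON-PROJECTIVE period vector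
  `perNP = (e₁ + f₁ + √2 e₃) + i (e₂ + f₂ + √2 e₃)` whose lattice orthogonal `Λ ∩ perNP^⊥` is
  NEGATIVE SEMI-DEFINITE of rank 19 (`perNP_orthogonal_nonpos`): any projective K3 realising it
  would carry an integral `(1,1)`-class of positive square orthogonal to `H^{2,0}`.
§B TIGHTNESS — `perNP` also shows the projectivity hypothesis cannot be weakened to
"`∃ v ≠ 0` in `Λ ∩ x^⊥`" nor to "`v² ≥ 0`" (`latE₃ ⊥ perNP`, `latE₃² = 0`), nor to
"`rank (Λ ∩ x^⊥) ≥ 19`": `k3PeriodSurjective_false_with_isotropic_v_of_marking`.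
§C LINE `IdeatorOneSketch` (lead prover-line-stmt-HodgeConjecture-15154-0; stubs T1
`stub_orbitClosureMeetsCM`, T2a `stub_cmPeriod_realised`, T2b `stub_realised_locallySurjective`,
T3 `stub_orbitInvariance`): no stub is false — see the `-- Line IdeatorOneSketch` section for the
case analysis each proof must contain (T1: three orbit-closure types by `rk (P_x ∩ Λ_ℚ)`,
Verbitsky 2015 Thm 4.8 WITH the 2017 erratum — the rank-one case is NOT dense; T2a: the
transcendental lattice must be matched AS AN ORIENTED lattice, Shioda–Inose–Mitani; T2b: fine).
-/

noncomputable section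

set_option linter.dupNamespace false

open scoped BigOperators ComplexConjugate Manifold ContDiff Matrix
open Literature.AlgebraicGeometry Literature.AlgebraicGeometry.Surfaces
  Literature.AlgebraicGeometry.HodgeTheory Literature.AlgebraicTopology.SingularHomology

namespace Summit.HodgeConjecture.HodgeConjecture.Cruxes.K3PeriodSurjective.Disproof

/-! ## The crux, reread -/

/-- The conclusion of the crux at the period vector `x`, VERBATIM (so that `crux_iff` is `Iff.rfl`):
a projective K3 surface `S` (unfolded `IsK3Surface`), a marking `φ`, an integral generator `p` of
`H⁴`, with integral classes `↔ ℤ²²`, cup product `= k3Form • p`, `φ⁻¹ x` of type `(2,0)` and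
spanning the `(2,0)`-classes. -/
def Realised (x : K3Index → ℂ) : Prop :=
  ∃ (S : Motives.SchemeOver ℂ) (_ : (Motives.IsSmoothProjective 2 S ∧
      Subsingleton (Motives.structureSheafCohomology S.left 1) ∧
      ∃ (A : HodgeModel 2 S) (η : Literature.Geometry.Kaehler.MForm 𝓘(ℝ, A.model) A.carrier ℂ 2),
        Literature.Geometry.Kaehler.IsHolomorphicInCharts η ∧ ∀ z, η z ≠ 0))
    (φ : complexBetti S (2 * 1) ≃ₗ[ℂ] (K3Index → ℂ)) (p : complexBetti S (2 * 2)),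
    IsIntegralClass p ∧
    (∀ q : complexBetti S (2 * 2), IsIntegralClass q → ∃ n : ℤ, q = n • p) ∧
    (∀ c : complexBetti S (2 * 1), IsIntegralClass c ↔ ∃ v : K3Index → ℤ, φ c = fun i => (v i : ℂ)) ∧
    (∀ a b : complexBetti S (2 * 1),
      cupProduct (rfl : 2 * 1 + 2 * 1 = 2 * 2) a b = k3Form (φ a) (φ b) • p) ∧
    IsOfHodgeType 2 S (2 * 1) 2 0 (φ.symm x) ∧
    (∀ σ : complexBetti S (2 * 1), IsOfHodgeType 2 S (2 * 1) 2 0 σ → ∃ t : ℂ, σ = t • φ.symm x)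

/-- The projectivity hypothesis of the crux at `x`: some lattice vector orthogonal to `x` has
positive square. -/
def HasPositiveLatticeVector (x : K3Index → ℂ) : Prop :=
  ∃ v : K3Index → ℤ, k3Form (fun i => (v i : ℂ)) x = 0 ∧ 0 < ∑ i, ∑ j, v i * k3Gram i j * v j

/-- The crux is definitionally the named Literature fact (planner Sketch, rechecked). -/
theorem crux_iff_fact :
    Theses.NikulinTwinTransport.K3PeriodSurjective ↔ Huybrechts_K3_periodSurjective_projective :=
  Iff.rfl

/-- The crux, reread through `Realised` (definitional). -/
theorem crux_iff :
    Theses.NikulinTwinTransport.K3PeriodSurjective ↔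
      ∀ x : K3Index → ℂ, k3Form x x = 0 → 0 < (k3Form (star x) x).re →
        HasPositiveLatticeVector x → Realised x :=
  Iff.rfl

/-- With the tree's THEOREM `hodgePQ_independent_of_hodgeModel_holds` the negatively used span
clause may be read in any single Hodge model `A` of the realising surface — the exotic-model
attack is closed by the tree itself. -/
theorem span_clause_iff_of_model {S : Motives.SchemeOver ℂ} (hS : Motives.IsSmoothProjective 2 S)
    (A : HodgeModel 2 S) (σ₀ : complexBetti S (2 * 1)) :
    (∀ σ : complexBetti S (2 * 1), IsOfHodgeType 2 S (2 * 1) 2 0 σ → ∃ t : ℂ, σ = t • σ₀) ↔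
      ∀ σ : complexBetti S (2 * 1), A.pullback (2 * 1) σ ∈ A.hodgePQ (2 * 1) 2 0 →
        ∃ t : ℂ, σ = t • σ₀ := by
  refine ⟨fun h σ hσ => h σ ⟨A, hσ⟩, fun h σ hσ => h σ ?_⟩
  exact (hodgePQ_independent_of_hodgeModel_holds.isOfHodgeType_iff hS A).1 hσ

/-! ## Witness vectors (coordinates on `Λ = E₈(−1) ⊕ E₈(−1) ⊕ U₁ ⊕ U₂ ⊕ U₃`, `Uₖ = ⟨eₖ, fₖ⟩`) -/

/-- `e₁`: a non-zero REAL ISOTROPIC vector (`(e₁.e₁) = 0`, `e₁ = ē₁`). -/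
def perE₁ : K3Index → ℂ := Sum.elim 0 (Sum.elim ![1, 0] 0)

/-- `e₁ + f₁`: a real vector of square `2` (`(x̄.x) = (x.x) = 2 > 0`). -/
def perE₁F₁ : K3Index → ℂ := Sum.elim 0 (Sum.elim ![1, 1] 0)

/-- `e₃ + f₃ ∈ Λ`: square `2`, orthogonal to `U₁ ⊕ U₂`. -/
def latE₃F₃ : K3Index → ℤ := Sum.elim 0 (Sum.elim 0 (Sum.elim 0 ![1, 1]))

/-- `e₃ ∈ Λ`: isotropic, non-zero. -/
def latE₃ : K3Index → ℤ := Sum.elim 0 (Sum.elim 0 (Sum.elim 0 ![1, 0]))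

/-- `e₁ ∈ Λ` as an integral vector. -/
def latE₁ : K3Index → ℤ := Sum.elim 0 (Sum.elim ![1, 0] 0)

/-- **The non-projective period vector** `perNP = (e₁ + f₁ + √2 e₃) + i (e₂ + f₂ + √2 e₃)`:
`Re` and `Im` are orthogonal of equal square `2`, so `perNP ∈ D`; a lattice vector
`v = (w₁, w₂, a₁e₁+b₁f₁, a₂e₂+b₂f₂, a₃e₃+b₃f₃)` is orthogonal to it iff
`a₁ + b₁ + √2 b₃ = 0 = a₂ + b₂ + √2 b₃`, i.e. (irrationality of `√2`) `b₃ = 0`, `b₁ = −a₁`,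
`b₂ = −a₂`, and then `v² = −q_{E₈}(w₁) − q_{E₈}(w₂) − 2a₁² − 2a₂² ≤ 0`: the Néron–Severi lattice
of a K3 with this period is negative semi-definite of rank `19` (no ample class). -/
def perNP : K3Index → ℂ :=
  Sum.elim 0 (Sum.elim ![1, 1] (Sum.elim ![Complex.I, Complex.I] ![((Real.sqrt 2 : ℝ) : ℂ) * (1 + Complex.I), 0]))

theorem perE₁_isotropic : k3Form perE₁ perE₁ = 0 := by
  simp [k3Form, k3Gram, hyperbolicPlaneGram, Fintype.sum_sum_type, Fin.sum_univ_two, perE₁]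

theorem perE₁_ne_zero : perE₁ ≠ 0 := by
  intro h
  have := congrFun h (Sum.inr (Sum.inl 0))
  simp [perE₁] at this

theorem perE₁_eq_intCast : perE₁ = fun i => (latE₁ i : ℂ) := by
  funext i
  rcases i with (i | i) | (i | (i | i)) <;> (try fin_cases i) <;> simp [perE₁, latE₁]

theorem latE₃F₃_orth_perE₁ : k3Form (fun i => (latE₃F₃ i : ℂ)) perE₁ = 0 := by
  simp [k3Form, k3Gram, hyperbolicPlaneGram, Fintype.sum_sum_type, Fin.sum_univ_two, perE₁, latE₃F₃]

theorem latE₃F₃_pos : 0 < ∑ i, ∑ j, latE₃F₃ i * k3Gram i j * latE₃F₃ j := by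
  simp [k3Gram, hyperbolicPlaneGram, Fintype.sum_sum_type, Fin.sum_univ_two, latE₃F₃]

theorem perE₁F₁_sq : k3Form perE₁F₁ perE₁F₁ = 2 := by
  simp [k3Form, k3Gram, hyperbolicPlaneGram, Fintype.sum_sum_type, Fin.sum_univ_two, perE₁F₁]
  norm_num

theorem perE₁F₁_pos : 0 < (k3Form (star perE₁F₁) perE₁F₁).re := by
  simp [k3Form, k3Gram, hyperbolicPlaneGram, Fintype.sum_sum_type, Fin.sum_univ_two, perE₁F₁]

theorem perE₁F₁_ne_zero : perE₁F₁ ≠ 0 := by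
  intro h
  have := congrFun h (Sum.inr (Sum.inl 0))
  simp [perE₁F₁] at this

theorem latE₃F₃_orth_perE₁F₁ : k3Form (fun i => (latE₃F₃ i : ℂ)) perE₁F₁ = 0 := by
  simp [k3Form, k3Gram, hyperbolicPlaneGram, Fintype.sum_sum_type, Fin.sum_univ_two, perE₁F₁,
    latE₃F₃]

/-! ## Bookkeeping on a marking datum `(φ, p)` -/

section Marking

variable {S : Motives.SchemeOver ℂ} {φ : complexBetti S (2 * 1) ≃ₗ[ℂ] (K3Index → ℂ)}
  {p : complexBetti S (2 * 2)}

/-- Cup products of marked classes: `φ⁻¹y ∪ φ⁻¹z = (y.z) p`. -/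
theorem cup_symm_symm
    (hcup : ∀ a b : complexBetti S (2 * 1),
      cupProduct (rfl : 2 * 1 + 2 * 1 = 2 * 2) a b = k3Form (φ a) (φ b) • p)
    (y z : K3Index → ℂ) :
    cupProduct (rfl : 2 * 1 + 2 * 1 = 2 * 2) (φ.symm y) (φ.symm z) = k3Form y z • p := by
  rw [hcup, LinearEquiv.apply_symm_apply, LinearEquiv.apply_symm_apply]

/-- Lattice vectors give integral classes under a marking. -/
theorem isIntegralClass_symm_intCast
    (hint : ∀ c : complexBetti S (2 * 1), IsIntegralClass c ↔ ∃ v : K3Index → ℤ, φ c = fun i => (v i : ℂ))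
    (w : K3Index → ℤ) : IsIntegralClass (φ.symm fun i => (w i : ℂ)) :=
  (hint _).2 ⟨w, LinearEquiv.apply_symm_apply _ _⟩

/-- **A marking is real**: complex conjugation of classes corresponds to coordinatewise
conjugation, `conj (φ⁻¹ y) = φ⁻¹ ȳ` (the standard basis vectors are integral classes, fixed by
conjugation, and `conjClass` is conjugate-linear). -/
theorem conjClass_symm
    (hint : ∀ c : complexBetti S (2 * 1), IsIntegralClass c ↔ ∃ v : K3Index → ℤ, φ c = fun i => (v i : ℂ))
    (y : K3Index → ℂ) :
    conjClass (Motives.ComplexPoints S) (2 * 1) (φ.symm y) = φ.symm (star y) := by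
  classical
  have hb : ∀ i : K3Index, IsRationalClass (φ.symm fun j => if i = j then (1 : ℂ) else 0) := by
    intro i
    refine ((hint _).2 ⟨fun j => if i = j then 1 else 0, ?_⟩).isRationalClass
    rw [LinearEquiv.apply_symm_apply]
    funext j
    by_cases h : i = j <;> simp [h]
  have hy : y = ∑ i, y i • fun j => if i = j then (1 : ℂ) else 0 := pi_eq_sum_univ y
  have hsy : star y = ∑ i, (star y) i • fun j => if i = j then (1 : ℂ) else 0 := pi_eq_sum_univ (star y)
  conv_lhs => rw [hy]
  rw [hsy, map_sum, map_sum, ← conjClassEquiv_apply, map_sum]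
  refine Finset.sum_congr rfl fun i _ => ?_
  rw [conjClassEquiv_apply, map_smul, map_smul, conjClass_smul, (hb i).conjClass_eq, Pi.star_apply,
    Complex.star_def]

/-- Hodge–Riemann read through a marking: `conj(φ⁻¹x) ∪ φ⁻¹x = (x̄.x) p`. -/
theorem cup_conj_symm_self
    (hint : ∀ c : complexBetti S (2 * 1), IsIntegralClass c ↔ ∃ v : K3Index → ℤ, φ c = fun i => (v i : ℂ))
    (hcup : ∀ a b : complexBetti S (2 * 1),
      cupProduct (rfl : 2 * 1 + 2 * 1 = 2 * 2) a b = k3Form (φ a) (φ b) • p)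
    (x : K3Index → ℂ) :
    cupProduct (rfl : 2 * 1 + 2 * 1 = 2 * 2) (conjClass (Motives.ComplexPoints S) (2 * 1) (φ.symm x))
      (φ.symm x) = k3Form (star x) x • p := by
  rw [conjClass_symm hint, cup_symm_symm hcup]

/-- A marked class is zero iff its coordinate vector is. -/
theorem symm_ne_zero {x : K3Index → ℂ} (hx : x ≠ 0) : φ.symm x ≠ 0 := by
  intro h
  exact hx (by simpa using congrArg φ h)

end Marking

/-! ## §A Load-bearing hypotheses -/

/-- `hV` of the tree's K3 lemmas, discharged (Voisin I Cor. 7.6, proved in the tree). -/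
theorem hV : ∀ (E : Type) [NormedAddCommGroup E] [NormedSpace ℂ E] [FiniteDimensional ℂ E]
    (M : Type) [TopologicalSpace M] [ChartedSpace E M],
    Voisin2002_closedForm_top_zero_not_exact E M :=
  fun E _ _ _ M _ _ => Voisin2002_closedForm_top_zero_not_exact_holds E M

/-- `hdR` of the tree's K3 lemmas, discharged (de Rham's theorem, proved in the tree). -/
theorem hdR : ∀ (E : Type) [NormedAddCommGroup E] [NormedSpace ℂ E] [FiniteDimensional ℂ E],
    Literature.NumberTheory.Transcendental.exists_deRhamIsoFamily 𝓘(ℝ, E) :=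
  fun E _ _ _ => Literature.NumberTheory.Transcendental.exists_deRhamIsoFamily_holds (E := E)

/-- The crux WITHOUT the positivity hypothesis `0 < re (x̄.x)`. -/
def K3PeriodSurjectiveWithoutPositivity : Prop :=
  ∀ x : K3Index → ℂ, k3Form x x = 0 → HasPositiveLatticeVector x → Realised x

/-- **Positivity is load-bearing**: without `0 < re (x̄.x)` the crux fails at `x = 0`
(`v = e₃ + f₃`): the realising K3 would have ALL its `(2,0)`-classes equal to `t • φ⁻¹ 0 = 0`,
but a K3 surface has a non-zero `(2,0)`-class (`IsK3Surface.exists_isOfHodgeType_twoZero_ne_zero`,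
proved in the tree from Voisin I Cor. 7.6). -/
theorem k3PeriodSurjective_false_without_positivity : ¬ K3PeriodSurjectiveWithoutPositivity := by
  intro h
  obtain ⟨S, hS, φ, p, -, -, -, -, -, hspan⟩ :=
    h 0 (k3Form_zero_left 0) ⟨latE₃F₃, k3Form_zero_right _, latE₃F₃_pos⟩
  obtain ⟨σ, hσ0, hσ⟩ := IsK3Surface.exists_isOfHodgeType_twoZero_ne_zero hV (S := S) hS
  obtain ⟨t, ht⟩ := hspan σ hσ
  exact hσ0 (by rw [ht, map_zero, smul_zero])

/-- The crux with positivity WEAKENED to `x ≠ 0`. -/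
def K3PeriodSurjectiveWithoutPositivity' : Prop :=
  ∀ x : K3Index → ℂ, x ≠ 0 → k3Form x x = 0 → HasPositiveLatticeVector x → Realised x

/-- **Positivity cannot be weakened to non-degeneracy**: at the non-zero real isotropic lattice
vector `x = e₁` (`v = e₃ + f₃`) the crux fails: `σ = φ⁻¹ e₁` would be a non-zero `(2,0)`-class,
INTEGRAL hence real (`σ̄ = σ`), with `σ̄ ∪ σ = σ ∪ σ = (e₁.e₁) p = 0` — contradicting the
Hodge–Riemann inequality `σ̄ ∪ σ ≠ 0` (`IsK3Surface.cupProduct_conjClass_self_ne_zero`, proved in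
the tree). So any proof must use `re (x̄.x) > 0` as a genuine positivity, not just `x ≠ 0`. -/
theorem k3PeriodSurjective_false_without_positivity' : ¬ K3PeriodSurjectiveWithoutPositivity' := by
  intro h
  obtain ⟨S, hS, φ, p, -, -, hint, hcup, h20, -⟩ :=
    h perE₁ perE₁_ne_zero perE₁_isotropic ⟨latE₃F₃, latE₃F₃_orth_perE₁, latE₃F₃_pos⟩
  have hσ0 : φ.symm perE₁ ≠ 0 := symm_ne_zero perE₁_ne_zero
  have HR := IsK3Surface.cupProduct_conjClass_self_ne_zero (S := S) hS h20 hσ0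
  have hreal : conjClass (Motives.ComplexPoints S) (2 * 1) (φ.symm perE₁) = φ.symm perE₁ := by
    refine IsIntegralClass.isRationalClass ?_ |>.conjClass_eq
    rw [perE₁_eq_intCast]
    exact isIntegralClass_symm_intCast hint latE₁
  rw [hreal, cup_symm_symm hcup, perE₁_isotropic, zero_smul] at HR
  exact HR rfl

/-- The crux WITHOUT the isotropy hypothesis `(x.x) = 0`. -/
def K3PeriodSurjectiveWithoutIsotropy : Prop :=
  ∀ x : K3Index → ℂ, 0 < (k3Form (star x) x).re → HasPositiveLatticeVector x → Realised x

/-- **Isotropy is load-bearing**: without `(x.x) = 0` the crux fails at `x = e₁ + f₁`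
(`(x̄.x) = (x.x) = 2 > 0`, `v = e₃ + f₃`): `σ = φ⁻¹ x` would be a `(2,0)`-class with
`σ ∪ σ = 2p`, while `σ ∪ σ = 0` for every `(2,0)`-class of a surface (type `(4,0)`;
`IsK3Surface.cupProduct_twoZero_self`, proved in the tree from the bigrading of the cup product,
model-independence and de Rham), forcing `p = 0`, i.e. `∪ ≡ 0` on `H² × H²` — against
Hodge–Riemann `σ̄ ∪ σ ≠ 0`. -/
theorem k3PeriodSurjective_false_without_isotropy : ¬ K3PeriodSurjectiveWithoutIsotropy := by
  intro h
  obtain ⟨S, hS, φ, p, -, -, -, hcup, h20, -⟩ :=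
    h perE₁F₁ perE₁F₁_pos ⟨latE₃F₃, latE₃F₃_orth_perE₁F₁, latE₃F₃_pos⟩
  have hσ0 : φ.symm perE₁F₁ ≠ 0 := symm_ne_zero perE₁F₁_ne_zero
  have h0 := IsK3Surface.cupProduct_twoZero_self hodgePQ_independent_of_hodgeModel_holds hdR
    (S := S) hS h20
  rw [cup_symm_symm hcup, perE₁F₁_sq, smul_eq_zero] at h0
  have hp0 : p = 0 := h0.resolve_left two_ne_zero
  have HR := IsK3Surface.cupProduct_conjClass_self_ne_zero (S := S) hS h20 hσ0
  rw [hcup, hp0, smul_zero] at HR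
  exact HR rfl


/-! ## The non-projective period vector `perNP` -/

theorem perNP_isotropic : k3Form perNP perNP = 0 := by
  simp [k3Form, k3Gram, hyperbolicPlaneGram, Fintype.sum_sum_type, Fin.sum_univ_two, perNP]

theorem k3Form_star_perNP : k3Form (star perNP) perNP = 4 := by
  simp [k3Form, k3Gram, hyperbolicPlaneGram, Fintype.sum_sum_type, Fin.sum_univ_two, perNP]
  norm_num

theorem perNP_pos : 0 < (k3Form (star perNP) perNP).re := by
  rw [k3Form_star_perNP]; norm_num

theorem perNP_ne_zero : perNP ≠ 0 := by
  intro h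
  have := congrFun h (Sum.inr (Sum.inl 0))
  simp [perNP] at this

/-- The linear form `v ↦ (v.perNP)` on the lattice, in coordinates:
`(a₁ + b₁) + (a₂ + b₂) i + b₃ √2 (1 + i)`. -/
theorem k3Form_intCast_perNP (v : K3Index → ℤ) :
    k3Form (fun i => (v i : ℂ)) perNP =
      ((v (Sum.inr (Sum.inl 0)) : ℂ) + v (Sum.inr (Sum.inl 1))) +
        ((v (Sum.inr (Sum.inr (Sum.inl 0))) : ℂ) + v (Sum.inr (Sum.inr (Sum.inl 1)))) * Complex.I +
        (v (Sum.inr (Sum.inr (Sum.inr 1))) : ℂ) * (((Real.sqrt 2 : ℝ) : ℂ) * (1 + Complex.I)) := by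
  simp [k3Form, k3Gram, hyperbolicPlaneGram, Fintype.sum_sum_type, Fin.sum_univ_two, perNP]
  ring

/-- `A + √2 C = 0` with `A, C ∈ ℤ` forces `C = 0` (irrationality of `√2`) and `A = 0`. -/
theorem int_add_sqrt_two_mul_eq_zero {A C : ℤ} (h : (A : ℝ) + Real.sqrt 2 * C = 0) :
    C = 0 ∧ A = 0 := by
  have hC : C = 0 := by
    by_contra hC
    have hC' : (C : ℝ) ≠ 0 := Int.cast_ne_zero.2 hC
    have hne := (irrational_iff_ne_rational _).1 irrational_sqrt_two (-A) C hC
    apply hne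
    rw [eq_div_iff hC', Int.cast_neg]
    linarith
  subst hC
  refine ⟨rfl, ?_⟩
  have : (A : ℝ) = 0 := by simpa using h
  exact_mod_cast this

/-- A lattice vector orthogonal to `perNP` has `b₃ = 0`, `b₁ = -a₁`, `b₂ = -a₂`. -/
theorem perNP_orthogonal_coords {v : K3Index → ℤ} (h : k3Form (fun i => (v i : ℂ)) perNP = 0) :
    v (Sum.inr (Sum.inr (Sum.inr 1))) = 0 ∧
      v (Sum.inr (Sum.inl 1)) = -v (Sum.inr (Sum.inl 0)) ∧
      v (Sum.inr (Sum.inr (Sum.inl 1))) = -v (Sum.inr (Sum.inr (Sum.inl 0))) := by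
  rw [k3Form_intCast_perNP] at h
  have hre := congrArg Complex.re h
  have him := congrArg Complex.im h
  simp only [Complex.add_re, Complex.mul_re, Complex.intCast_re, Complex.intCast_im,
    Complex.I_re, Complex.I_im, Complex.ofReal_re, Complex.ofReal_im, Complex.one_re,
    Complex.one_im, Complex.add_im, Complex.mul_im, Complex.zero_re, Complex.zero_im,
    mul_zero, zero_mul, sub_zero, mul_one, add_zero, zero_add] at hre him
  have h1 : ((v (Sum.inr (Sum.inl 0)) + v (Sum.inr (Sum.inl 1)) : ℤ) : ℝ) +
      Real.sqrt 2 * (v (Sum.inr (Sum.inr (Sum.inr 1)))) = 0 := by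
    push_cast; linarith
  have h2 : ((v (Sum.inr (Sum.inr (Sum.inl 0))) + v (Sum.inr (Sum.inr (Sum.inl 1))) : ℤ) : ℝ) +
      Real.sqrt 2 * (v (Sum.inr (Sum.inr (Sum.inr 1)))) = 0 := by
    push_cast; linarith
  obtain ⟨h3, hA⟩ := int_add_sqrt_two_mul_eq_zero h1
  obtain ⟨-, hB⟩ := int_add_sqrt_two_mul_eq_zero h2
  exact ⟨h3, by linarith, by linarith⟩

/-- **`Λ ∩ perNP^⊥` is negative semi-definite**: every lattice vector orthogonal to `perNP` has
square `≤ 0` (`v² = -q_{E₈}(w₁) - q_{E₈}(w₂) - 2a₁² - 2a₂²`). So `perNP` is a period point which NO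
projective K3 surface realises. -/
theorem perNP_orthogonal_nonpos {v : K3Index → ℤ} (h : k3Form (fun i => (v i : ℂ)) perNP = 0) :
    ∑ i, ∑ j, v i * k3Gram i j * v j ≤ 0 := by
  obtain ⟨h3, h1, h2⟩ := perNP_orthogonal_coords h
  rw [k3Lattice_quadratic_eq, h1, h2, h3]
  have q1 := CartanMatrix_E₈_quadratic_nonneg (fun i => v (Sum.inl (Sum.inl i)))
  have q2 := CartanMatrix_E₈_quadratic_nonneg (fun i => v (Sum.inl (Sum.inr i)))
  nlinarith [sq_nonneg (v (Sum.inr (Sum.inl 0))), sq_nonneg (v (Sum.inr (Sum.inr (Sum.inl 0))))]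

/-- `perNP` has no positive lattice vector in its orthogonal: it violates the projectivity
hypothesis of the crux. -/
theorem not_hasPositiveLatticeVector_perNP : ¬ HasPositiveLatticeVector perNP := by
  rintro ⟨v, hv, hpos⟩
  exact absurd (perNP_orthogonal_nonpos hv) (not_le.2 hpos)

theorem latE₃_orth_perNP : k3Form (fun i => (latE₃ i : ℂ)) perNP = 0 := by
  simp [k3Form, k3Gram, hyperbolicPlaneGram, Fintype.sum_sum_type, Fin.sum_univ_two, perNP, latE₃]

theorem latE₃_isotropic : ∑ i, ∑ j, latE₃ i * k3Gram i j * latE₃ j = 0 := by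
  simp [k3Gram, hyperbolicPlaneGram, Fintype.sum_sum_type, Fin.sum_univ_two, latE₃]

theorem latE₃_ne_zero : latE₃ ≠ 0 := by
  intro h
  have := congrFun h (Sum.inr (Sum.inr (Sum.inr 0)))
  simp [latE₃] at this

/-! ## §A (continued) Projectivity is load-bearing — granted `Huybrechts_K3_marking_exists` -/

/-- **No projective K3 surface realises `perNP`**, granted the tree's named fact
`Huybrechts_K3_marking_exists` (every K3 surface `S` has a marking `η` with an ample lattice vector
`u ⊥ x₀`, `u² > 0`). Proof: read the ample class `c = η⁻¹ u` through the would-be marking `φ` of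
perNP: `φ c = w ∈ ℤ²²`; comparing `c ∪ c` and `σ̄ ∪ σ` in the two markings (`σ = φ⁻¹ perNP = t σ₀`,
Hodge–Riemann positivity of both periods) gives `p' = n p` with `n ≥ 1`, hence `w² = n u² > 0`,
while `(w.perNP) p = c ∪ σ = t (u.x₀) p' = 0`; but `Λ ∩ perNP^⊥` is negative semi-definite. -/
theorem not_realised_perNP_of_marking (hM : Huybrechts_K3_marking_exists) : ¬ Realised perNP := by
  rintro ⟨S, hS, φ, p, hp, hgen, hint, hcup, h20, -⟩
  obtain ⟨η, p', x₀, hp'0, ⟨hp', -, hint', hcup', -, hspan'⟩, -, hx₀pos, u, hux₀, hupos⟩ := hM S hS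
  -- the ample class of the marking fact and its coordinates in the marking `φ`
  set c : complexBetti S (2 * 1) := η.symm (fun i => (u i : ℂ)) with hc
  have hηc : η c = fun i => (u i : ℂ) := LinearEquiv.apply_symm_apply _ _
  obtain ⟨w, hw⟩ := (hint c).1 (isIntegralClass_symm_intCast hint' u)
  have hcc' : cupProduct (rfl : 2 * 1 + 2 * 1 = 2 * 2) c c =
      ((∑ i, ∑ j, u i * k3Gram i j * u j : ℤ) : ℂ) • p' := by
    rw [hcup', hηc, k3Form_intCast]
  have hcc : cupProduct (rfl : 2 * 1 + 2 * 1 = 2 * 2) c c =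
      ((∑ i, ∑ j, w i * k3Gram i j * w j : ℤ) : ℂ) • p := by
    rw [hcup, hw, k3Form_intCast]
  -- `p ≠ 0`
  have hU0 : ((∑ i, ∑ j, u i * k3Gram i j * u j : ℤ) : ℂ) ≠ 0 := by exact_mod_cast hupos.ne'
  have hp0 : p ≠ 0 := by
    rintro rfl
    rw [smul_zero] at hcc
    rw [hcc] at hcc'
    exact (smul_ne_zero hU0 hp'0) hcc'.symm
  -- `σ = φ⁻¹ perNP = t • σ₀`, `t ≠ 0`
  obtain ⟨t, ht⟩ := hspan' (φ.symm perNP) h20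
  have hσ0 : φ.symm perNP ≠ 0 := symm_ne_zero perNP_ne_zero
  have ht0 : t ≠ 0 := by
    rintro rfl
    exact hσ0 (by rw [ht, zero_smul])
  -- `p' = n • p`
  obtain ⟨n, hn⟩ := hgen p' hp'
  rw [← Int.cast_smul_eq_zsmul ℂ n p] at hn
  -- Hodge–Riemann through both markings
  have eσ : cupProduct (rfl : 2 * 1 + 2 * 1 = 2 * 2)
      (conjClass (Motives.ComplexPoints S) (2 * 1) (φ.symm perNP)) (φ.symm perNP) = (4 : ℂ) • p := by
    rw [cup_conj_symm_self hint hcup, k3Form_star_perNP]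
  have eσ' : cupProduct (rfl : 2 * 1 + 2 * 1 = 2 * 2)
      (conjClass (Motives.ComplexPoints S) (2 * 1) (φ.symm perNP)) (φ.symm perNP) =
        (starRingEnd ℂ t * t * k3Form (star x₀) x₀ * (n : ℂ)) • p := by
    rw [ht, conjClass_smul, LinearMap.map_smul₂, map_smul, cup_conj_symm_self hint' hcup', hn,
      smul_smul, smul_smul, smul_smul]
  have h4 : (4 : ℂ) = starRingEnd ℂ t * t * k3Form (star x₀) x₀ * (n : ℂ) :=
    smul_left_injective ℂ hp0 (eσ.symm.trans eσ')
  -- hence `0 < n`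
  have hN : 0 < Complex.normSq t := Complex.normSq_pos.2 ht0
  have hr₀ : k3Form (star x₀) x₀ = (((k3Form (star x₀) x₀).re : ℝ) : ℂ) := by
    apply Complex.ext
    · simp
    · simp [k3Form_star_self_im x₀]
  have h4' : (4 : ℝ) = Complex.normSq t * (k3Form (star x₀) x₀).re * n := by
    rw [← Complex.normSq_eq_conj_mul_self, hr₀] at h4
    exact_mod_cast h4
  have hn0 : (0 : ℝ) < n := by
    by_contra hle
    have hle := not_lt.1 hle
    have hNR : 0 < Complex.normSq t * (k3Form (star x₀) x₀).re := mul_pos hN hx₀pos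
    nlinarith
  have hn0' : (0 : ℤ) < n := by exact_mod_cast hn0
  -- `w² = n u² > 0`
  have hWU : ((∑ i, ∑ j, w i * k3Gram i j * w j : ℤ) : ℂ) =
      ((∑ i, ∑ j, u i * k3Gram i j * u j : ℤ) : ℂ) * (n : ℂ) := by
    refine smul_left_injective ℂ hp0 (hcc.symm.trans ?_)
    rw [hcc', hn, smul_smul]
  have hWU' : (∑ i, ∑ j, w i * k3Gram i j * w j) = (∑ i, ∑ j, u i * k3Gram i j * u j) * n := by
    exact_mod_cast hWU
  have hWpos : 0 < ∑ i, ∑ j, w i * k3Gram i j * w j := by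
    rw [hWU']; exact mul_pos hupos hn0'
  -- `w ⊥ perNP`
  have hwx : k3Form (fun i => (w i : ℂ)) perNP = 0 := by
    have e1 : cupProduct (rfl : 2 * 1 + 2 * 1 = 2 * 2) c (φ.symm perNP) =
        k3Form (fun i => (w i : ℂ)) perNP • p := by
      rw [hcup, hw, LinearEquiv.apply_symm_apply]
    have e2 : cupProduct (rfl : 2 * 1 + 2 * 1 = 2 * 2) c (φ.symm perNP) = 0 := by
      rw [ht, map_smul, hcup', hηc, LinearEquiv.apply_symm_apply, hux₀, zero_smul, smul_zero]
    rw [e1, smul_eq_zero] at e2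
    exact e2.resolve_right hp0
  exact absurd (perNP_orthogonal_nonpos hwx) (not_le.2 hWpos)

/-- The crux WITHOUT the projectivity hypothesis `∃ v ∈ Λ ∩ x^⊥, v² > 0` ("every point of the
period domain is the period of a PROJECTIVE K3 surface"). -/
def K3PeriodSurjectiveWithoutProjectivity : Prop :=
  ∀ x : K3Index → ℂ, k3Form x x = 0 → 0 < (k3Form (star x) x).re → Realised x

/-- **Projectivity is load-bearing** (granted the marking fact): the period point `perNP` is not
realised by any projective K3 surface. -/
theorem k3PeriodSurjective_false_without_projectivity_of_marking (hM : Huybrechts_K3_marking_exists) :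
    ¬ K3PeriodSurjectiveWithoutProjectivity := fun h =>
  not_realised_perNP_of_marking hM (h perNP perNP_isotropic perNP_pos)

/-! ## §B Tightness of the projectivity hypothesis -/

/-- The crux with `v² > 0` WEAKENED to "`v ≠ 0` and `v² ≥ 0`" in the projectivity hypothesis. -/
def K3PeriodSurjectiveWithIsotropicV : Prop :=
  ∀ x : K3Index → ℂ, k3Form x x = 0 → 0 < (k3Form (star x) x).re →
    (∃ v : K3Index → ℤ, v ≠ 0 ∧ k3Form (fun i => (v i : ℂ)) x = 0 ∧ 0 ≤ ∑ i, ∑ j, v i * k3Gram i j * v j) →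
    Realised x

/-- **`v² > 0` cannot be weakened to `v ≠ 0, v² ≥ 0`** (granted the marking fact): `perNP` has the
non-zero isotropic lattice vector `e₃` in its orthogonal (indeed `rank (Λ ∩ perNP^⊥) = 19`), yet is
not realised by a projective K3. -/
theorem k3PeriodSurjective_false_with_isotropic_v_of_marking (hM : Huybrechts_K3_marking_exists) :
    ¬ K3PeriodSurjectiveWithIsotropicV := fun h =>
  not_realised_perNP_of_marking hM
    (h perNP perNP_isotropic perNP_pos ⟨latE₃, latE₃_ne_zero, latE₃_orth_perNP, latE₃_isotropic.ge⟩)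

/-- Conversely the crux itself says nothing at `perNP` (its projectivity hypothesis fails there),
so `perNP` is NOT a counterexample to the crux — recorded to prevent re-discovery. -/
theorem crux_vacuous_at_perNP :
    ¬ HasPositiveLatticeVector perNP := not_hasPositiveLatticeVector_perNP


/-! ## Line `IdeatorOneSketch` (lead prover-line-stmt-HodgeConjecture-15154-0) — stub-by-stub attack

Stubs (Cruxes/K3PeriodSurjective/Lines/IdeatorOneSketch.lean): T1 `stub_orbitClosureMeetsCM`,
T2a `stub_cmPeriod_realised`, T2b `stub_realised_locallySurjective`, T3 `stub_orbitInvariance`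
(landed, p96253). Findings:

* **T2a and T2b are IMPLIED BY THE CRUX** (T2b trivially — `stub_realised_locallySurjective_of_crux`
  below, `W = univ`; T2a because a CM period `y` — twenty independent lattice vectors in `y^⊥` — is
  automatically projective: `Λ ∩ y^⊥` has signature `(1,19)`, so it contains a positive vector; a
  lattice lemma not formalised here). Hence neither can be false unless the crux is; they are sound
  as STEPS. Their cost is constructive (an actual K3 surface as a `ℂ`-scheme with computed `H²`,
  cup form, Hodge types: Kummer / Shioda–Inose), not logical.
* **T2a, orientation caveat for the prover**: Shioda–Inose–Mitani classify singular K3 surfaces by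
  ORIENTED positive-definite even binary lattices (`T(X)` oriented by `(Re σ, Im σ)`); a CM period
  `y` must be realised by the member of the conjugate pair `{X, X̄}` whose oriented `T` matches
  `(Re y, Im y)` — for a non-ambiguous binary form the two are NOT isomorphic as marked surfaces.
  Then the marking extends from `T ⊕ NS` to `Λ` by Nikulin (Huybrechts Ch. 14 Cor. 3.10-type
  uniqueness of the primitive embedding of a rank-2 lattice). No falsity, but the statement as typed
  (`IsMarkedK3 S φ p y` with `φ⁻¹ y` of type `(2,0)`) does force this orientation bookkeeping.
* **T1 is TRUE but its proof is a THREE-CASE analysis**, not a blanket density statement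
  (Verbitsky, *Ergodic complex structures on hyperkähler manifolds*, Acta Math. 2015, Thm. 4.8, WITH
  the erratum (Verbitsky 2017/2019, arXiv:1708.05802): by `r = rk_ℚ (P_x ∩ Λ_ℚ)` for the positive
  plane `P_x = ⟨Re x, Im x⟩`: `r = 0` — orbit dense (Ratner/Shah for `SO°(1,19) ⊂ SO(3,19)`), so its
  closure contains CM points; `r = 2` — `x` is itself CM (take `y = x`, `g = 1`, `t = 1`:
  `stub_orbitClosureMeetsCM_of_isCM` below); `r = 1` — the orbit closure is NOT dense (the erratum)
  but is the `O(Λ)`-saturation of `{y : P_y ∋ v}` for the rational vector `v ∈ P_x`, which contains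
  CM points (`v^⊥_ℚ` has signature `(2,19)`, so a rational positive `w ⊥ v` exists and
  `⟨v, w⟩` is a rational positive plane). A proof of T1 quoting only "orbits are dense" is WRONG in
  case `r = 1`; the statement survives because CM points lie on every such Noether–Lefschetz locus.
* **T3** is landed; the crux is `O(Λ) × ℂˣ`-invariant (tree lemmas), consistent with §A–§B: all
  witnesses above are statements about `O(Λ) × ℂˣ`-invariant properties (`(x.x) = 0`,
  `re (x̄.x) > 0` up to `|t|²`, signature of `Λ ∩ x^⊥`).
* **Joint sufficiency**: `K3PeriodSurjective_of` is kernel-checked in the skeleton; no gap.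
-/

/-- T2b of the line is implied by the crux itself (take `W = univ`): it cannot fail unless the crux
does, and as typed it carries no local-Torelli content — its value is only as a step FROM a realised
CM point when the crux is not yet known. -/
theorem stub_realised_locallySurjective_of_crux (h : Theses.NikulinTwinTransport.K3PeriodSurjective)
    (y : K3Index → ℂ) :
    ∃ W ∈ nhds y, ∀ z ∈ W, (k3Form z z = 0 ∧ 0 < (k3Form (star z) z).re) →
      HasPositiveLatticeVector z → Realised z :=
  ⟨Set.univ, Filter.univ_mem, fun z _ hz hv => h z hz.1 hz.2 hv⟩

/-- T1 of the line at a CM point is trivial (`y = x`, `g = 1`, `t = 1`): the case `r = 2` of the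
three-case analysis. Stated on the orbit set of the skeleton verbatim. -/
theorem stub_orbitClosureMeetsCM_of_isCM (x : K3Index → ℂ)
    (hCM : ∃ N : Fin 20 → (K3Index → ℤ), LinearIndependent ℤ N ∧
      ∀ k : Fin 20, k3Form (fun i => (N k i : ℂ)) x = 0) :
    ∃ y : K3Index → ℂ, y ∈ closure {z : K3Index → ℂ | ∃ (g : Matrix K3Index K3Index ℤ) (t : ℂ),
        g.transpose * k3Gram * g = k3Gram ∧ IsUnit g ∧ t ≠ 0 ∧ z = t • (g.map (Int.cast : ℤ → ℂ) *ᵥ x)} ∧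
      (∃ N : Fin 20 → (K3Index → ℤ), LinearIndependent ℤ N ∧
        ∀ k : Fin 20, k3Form (fun i => (N k i : ℂ)) y = 0) := by
  refine ⟨x, subset_closure ⟨1, 1, by simp, isUnit_one, one_ne_zero, ?_⟩, hCM⟩
  have h1 : (1 : Matrix K3Index K3Index ℤ).map (Int.cast : ℤ → ℂ) = 1 := by
    rw [Matrix.map_one Int.cast Int.cast_zero Int.cast_one]
  rw [h1, Matrix.one_mulVec, one_smul]

end Summit.HodgeConjecture.HodgeConjecture.Cruxes.K3PeriodSurjective.Disproof

end
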